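import Mathlib
import Literature.GroupTheory.CombinatorialGroupTheory.SignedHurwitzAction
import Literature.GroupTheory.CombinatorialGroupTheory.SignedHurwitzStabilisation
import Literature.GroupTheory.CombinatorialGroupTheory.SignedHurwitzExchange
import HarnessLib
import Summits.SmoothPoincare4.SmoothPoincare4.Theorems.ConvexBisectionAcyclicBisectionRigidityStubMatsumotoNormalFormAux

/-!
# Stub D-alg as registered is false: the classes of a normal form are only determined up to sign

Helper file for stub D-alg (`stub_matsumotoNormalForm`) of line `folded-curve-branch-locus` of the
crux `ConvexBisection.AcyclicBisectionRigidity` (item stmt-SmoothPoincare4-10507).  The registered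
signature asks for the signed Hurwitz orbit of every four-letter genus-one word with primitive
classes and trivial monodromy to contain an EXACTLY-signed normal form
`[(u, η), (u, ¬η), (w, η'), (w, ¬η')]`.  `helper_matsumotoNormalForm_exact_false` refutes this with
the word `[(e₁,+), (−e₁,+), (e₁,−), (e₁,−)]` (`Matsumoto.cexWord`): its letters are primitive, its
monodromy is `T T T⁻¹ T⁻¹ = 1` (`T_{−e₁} = T_{e₁}`), all pairings of its classes vanish, so both
alternatives of every `HurwitzStep` are transpositions and the orbit consists of permutations of the
word (`Matsumoto.perm_of_orbit`); the signed count of letters of class `−e₁`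
(`Matsumoto.negCount`) is `1` on the word and `0` on every exactly-signed normal form.  The correct
statement (classes up to sign, `u' = ±u`, `w' = ±w`) is `helper_matsumotoNormalForm_pm` in
`…StubMatsumotoNormalForm.lean`; geometrically nothing is lost since `T_{(−v,ε)} = T_{(v,ε)}`
(a vanishing cycle carries no orientation).

Everything is proved; Mathlib and the `SignedHurwitz` files only.
-/

set_option linter.dupNamespace false

namespace Summit.SmoothPoincare4.SmoothPoincare4.Theorems.AcyclicBisectionRigidity.FoldedCurveBranchLocus

open Literature.GroupTheory.CombinatorialGroupTheory.SignedHurwitz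

namespace Matsumoto

/-- The first basis vector `e₁` of `ℤ² = H₁(F_{1,1}; ℤ)`. [folklore] -/
def cexE : Fin 1 ⊕ Fin 1 → ℤ := Pi.single (Sum.inl 0) 1

/-- The counterexample word `[(e₁,+), (−e₁,+), (e₁,−), (e₁,−)]`. [folklore] -/
def cexWord : IntWord 1 := [(cexE, true), (-cexE, true), (cexE, false), (cexE, false)]

/-- `e₁` is primitive. [folklore] -/
theorem isPrimitive_cexE : IsPrimitive cexE := fun d hd =>
  isUnit_of_dvd_one (by simpa [cexE] using hd (Sum.inl 0))

/-- `−e₁` is primitive. [folklore] -/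
theorem isPrimitive_neg_cexE : IsPrimitive (-cexE) := fun d hd =>
  isUnit_of_dvd_one (by
    have := hd (Sum.inl 0)
    simp only [cexE, Pi.neg_apply, Pi.single_eq_same] at this
    exact (dvd_neg.mp this))

/-- `e₁ ≠ −e₁`. [folklore] -/
theorem cexE_ne_neg : cexE ≠ -cexE := by
  intro h
  have := congrFun h (Sum.inl 0)
  simp [cexE] at this

/-- All letters of the counterexample word are primitive. [folklore] -/
theorem cexWord_primitive : ∀ x ∈ cexWord, IsPrimitive x.1 := by
  intro x hx
  simp only [cexWord, List.mem_cons, List.not_mem_nil, or_false] at hx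
  rcases hx with rfl | rfl | rfl | rfl
  · exact isPrimitive_cexE
  · exact isPrimitive_neg_cexE
  · exact isPrimitive_cexE
  · exact isPrimitive_cexE

/-- The counterexample word has trivial signed monodromy: `T T (T⁻¹ T⁻¹) = 1`
(`T_{−e₁} = T_{e₁}`). [folklore] -/
theorem wordProduct_cexWord : wordProduct (stdSymp ℤ 1) cexWord = 1 := by
  rw [cexWord, wordProduct_four, transvection_neg_fst]
  have h := tv_mul_tv_not cexE true
  rw [Bool.not_true] at h
  calc transvection (stdSymp ℤ 1) (cexE, true) * (transvection (stdSymp ℤ 1) (cexE, true) *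
        (transvection (stdSymp ℤ 1) (cexE, false) * transvection (stdSymp ℤ 1) (cexE, false)))
      = transvection (stdSymp ℤ 1) (cexE, true) *
        ((transvection (stdSymp ℤ 1) (cexE, true) * transvection (stdSymp ℤ 1) (cexE, false)) *
          transvection (stdSymp ℤ 1) (cexE, false)) := by simp only [mul_assoc]
    _ = 1 := by rw [h, one_mul, h]

/-- The letters of the counterexample word have classes `±e₁`. [folklore] -/
theorem fst_of_mem_cexWord {x : (Fin 1 ⊕ Fin 1 → ℤ) × Bool} (hx : x ∈ cexWord) :
    x.1 = cexE ∨ x.1 = -cexE := by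
  simp only [cexWord, List.mem_cons, List.not_mem_nil, or_false] at hx
  rcases hx with rfl | rfl | rfl | rfl <;> simp

/-- Classes `±e₁` pair to zero. [folklore] -/
theorem om_eq_zero_of_pm {a b : Fin 1 ⊕ Fin 1 → ℤ} (ha : a = cexE ∨ a = -cexE) (hb : b = cexE ∨ b =
    -cexE) :
    stdSymp ℤ 1 a b = 0 := by
  have h0 := stdSymp_int_self 1 cexE
  rcases ha with rfl | rfl <;> rcases hb with rfl | rfl <;> simp [h0]

/-- **The orbit invariant.**  Every word in the signed Hurwitz orbit of the counterexample word is a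
permutation of it: all pairings of its letters vanish, so each Hurwitz move is a transposition.
[folklore] -/
theorem perm_of_orbit {l : IntWord 1} (h : HurwitzOrbit (stdSymp ℤ 1) cexWord l) : l.Perm cexWord
    := by
  induction h with
  | refl => exact List.Perm.refl _
  | tail _ hstep ih =>
    obtain ⟨pre, suf, a, b, rfl, rfl | rfl⟩ := hstep
    · have ha := fst_of_mem_cexWord (ih.subset (by simp : a ∈ pre ++ a :: b :: suf))
      have hb := fst_of_mem_cexWord (ih.subset (by simp : b ∈ pre ++ a :: b :: suf))
      rw [om_eq_zero_of_pm ha hb, mul_zero, zero_smul, add_zero, Prod.mk.eta]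
      exact (List.Perm.append_left pre (List.Perm.swap a b suf)).trans ih
    · have ha := fst_of_mem_cexWord (ih.subset (by simp : a ∈ pre ++ a :: b :: suf))
      have hb := fst_of_mem_cexWord (ih.subset (by simp : b ∈ pre ++ a :: b :: suf))
      rw [om_eq_zero_of_pm hb ha, mul_zero, zero_smul, sub_zero, Prod.mk.eta]
      exact (List.Perm.append_left pre (List.Perm.swap a b suf)).trans ih

/-- The signed count of letters with class `−e₁`. [folklore] -/
noncomputable def negCount (x : (Fin 1 ⊕ Fin 1 → ℤ) × Bool) : ℤ :=
  if x.1 = -cexE then sgn x.2 else 0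

/-- On the counterexample word the signed count is `1`. [folklore] -/
theorem negCount_cexWord : (cexWord.map negCount).sum = 1 := by
  simp [cexWord, negCount, cexE_ne_neg]

/-- On an exactly-signed normal form the signed count is `0`. [folklore] -/
theorem negCount_nf (u w : Fin 1 ⊕ Fin 1 → ℤ) (η η' : Bool) :
    ([(u, η), (u, !η), (w, η'), (w, !η')].map negCount).sum = 0 := by
  have hsn : ∀ b : Bool, (sgn (!b) : ℤ) = -sgn b := fun b => by cases b <;> simp
  simp only [List.map_cons, List.map_nil, List.sum_cons, List.sum_nil, negCount]
  by_cases hu : u = -cexE <;> by_cases hw : w = -cexE <;> simp [hu, hw, hsn]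

end Matsumoto

open Matsumoto in
/-- **The registered form of stub D-alg is false.**  The exactly-signed normal form
`[(u, η), (u, ¬η), (w, η'), (w, ¬η')]` cannot always be reached: the word
`[(e₁,+), (−e₁,+), (e₁,−), (e₁,−)]` has four primitive letters and trivial signed monodromy, but
every word in its signed Hurwitz orbit is a permutation of it (all pairings vanish, so every move is
a transposition), and no permutation of it is of that form (the signed count of letters with class
`−e₁` is `1` on the orbit and `0` on every such normal form).  Hence the classes of a normal form must
be allowed up to sign, as in `helper_matsumotoNormalForm_pm`. [folklore] -/
theorem helper_matsumotoNormalForm_exact_false :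
    ¬ ∀ (l : IntWord 1), l.length = 4 → (∀ x ∈ l, IsPrimitive x.1) → wordProduct (stdSymp ℤ 1) l =
        1 →
      ∃ (u w : Fin 1 ⊕ Fin 1 → ℤ) (η η' : Bool),
        HurwitzOrbit (stdSymp ℤ 1) l [(u, η), (u, !η), (w, η'), (w, !η')] := by
  intro h
  obtain ⟨u, w, η, η', horb⟩ := h cexWord rfl cexWord_primitive wordProduct_cexWord
  have hperm := perm_of_orbit horb
  have h1 := (hperm.map negCount).sum_eq
  rw [negCount_nf, negCount_cexWord] at h1
  exact zero_ne_one h1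

end Summit.SmoothPoincare4.SmoothPoincare4.Theorems.AcyclicBisectionRigidity.FoldedCurveBranchLocus
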